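import Mathlib
import Summits.NavierStokesRegularity.NavierStokesRegularity.Theorems.FilamentSkeletonRssSkeletonJ1RLiaSelfDerivWindowZone
import Summits.NavierStokesRegularity.NavierStokesRegularity.Theorems.FilamentSkeletonRssSkeletonJ1RLiaSelfDerivOuterZones
import Summits.NavierStokesRegularity.NavierStokesRegularity.Theorems.FilamentSkeletonRssSkeletonJ1RLiaSelfDerivFrame
import Summits.NavierStokesRegularity.NavierStokesRegularity.Theorems.FilamentSkeletonRssSkeletonJ1RMismatchTools

/-!
# Crux `SkeletonJ1R` (stmt-NavierStokesRegularity-23610) · line `streamline_kantorovich_R` · toward stub F2-d (`LiaDefectDerivBL`, v7), brick S3′ for B1′: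
# THE DERIVATIVE LOCAL-INDUCTION ESTIMATE — `‖∫ D dσ − Λ_e(R)•X′τ × X‴τ‖` for a curve with a LINEAR curvature envelope and `C³` window data

Hand `leafhand-ns-filamentskeletonrs-1` (gen 0), `--supports stmt-NavierStokesRegularity-23610 --as helper`.  MODEL rung, NEGATIVE side of the ladder:
kernel calculus for a HYPOTHETICAL filament-type blow-up skeleton; nothing here is a claim about Navier–Stokes regularity; the stub and the crux stay OPEN.

Derivative analogue of S3 (`…LiaSelfEnvelope.selfStrand_sub_lia_le`).  `D(σ)` = the symmetrized self-strand derivative integrand (`…LiaSelfDerivSymm`),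
`Λ_e(R) = arsinh(R/e) − R/√(R²+e²)`.  Unit-speed `C²` curve with envelope `‖X″σ‖ ≤ ε₀ + ε₁|σ|`, global curvature ceiling `κm`, global tangent oscillation
`θ ≤ 1`, and on the window `|p − τ| ≤ R` a derivative `Z` of `X″` with `‖Z‖ ≤ H`, `‖Zp − Zτ‖ ≤ H′|p−τ|`; `0 < R ≤ L`, `κ_R ≥ ε₀+ε₁(|τ|+R)`, `κ_R R ≤ 1`,
`κ0 ≥ ε₀ + ε₁|τ|`.  Then `D` is integrable and
  `‖∫ D − Λ_e(R)•X′τ×Zτ‖ ≤ 2R(8H′ + 84κ_R H) + 8(κ_R R)²H·Λ_e(R) + 72ε₁ log(L/R) + 72πκ0/R + (64θ/L + 8κm)π/L`   (`symmDerivStrand_sub_lia_le`).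
Zones: window (`…LiaSelfDerivWindowZone`), envelope zone (`…LiaSelfDerivOuterZones`, the `κ0/s²` part dominated by the Cauchy kernel `72κ0(R²+s²)⁻¹` on BOTH
sides, the `ε₁/|s|` part by the logarithmic pieces of S3), far zone (Cauchy tail), frame `…LiaSelfDerivFrame`.  For the LIA reference at collar points
(`R = r₀√Γ`, `L ≍ ℓ`, `H ≍ b`, `H′ ≍ b/ℓ`, `κ ≍ bℓ`, `b = |β|⁻¹`) every term is `O((√Γ+|τ|)/(ℓ√log Γ))` after `× Γγ_j/4π` — the RATE-B budget of B1′.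
What remains for F2-d: the reference inputs S4′ (`Z = x‴`, `H`, `H′`, `κm`) and the B1′ bookkeeping.
-/

set_option linter.dupNamespace false -- `NavierStokesRegularity.NavierStokesRegularity` path/namespace repetition is the tree convention

noncomputable section

namespace Summit.NavierStokesRegularity.NavierStokesRegularity.Theorems.SkeletonJ1RLiaSelf

open Set Function Filter Real Topology MeasureTheory
open Literature.Analysis.FluidPDE
open Summit.NavierStokesRegularity.NavierStokesRegularity.Theorems.SkeletonJ1RMismatchTools (integral_inv_sq_add_sq integrable_inv_sq_add_sq)
open scoped InnerProductSpace BigOperators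

variable {X : ℝ → EuclideanSpace ℝ (Fin 3)}

set_option maxHeartbeats 1600000 in
/-- **THE DERIVATIVE LOCAL-INDUCTION ESTIMATE (S3′)** — see the module docstring. [folklore] -/
theorem symmDerivStrand_sub_lia_le (hX : ContDiff ℝ 2 X) (hunit : ∀ s, ‖deriv X s‖ = 1) {e : ℝ} (he : 0 < e)
    {τ R L ε₀ ε₁ H H' θ κR κ0 κm : ℝ} {Z : ℝ → EuclideanSpace ℝ (Fin 3)} (hR : 0 < R) (hRL : R ≤ L) (hε₀ : 0 ≤ ε₀) (hε₁ : 0 ≤ ε₁)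
    (henv : ∀ σ, ‖deriv (deriv X) σ‖ ≤ ε₀ + ε₁ * |σ|) (hH0 : 0 ≤ H) (hH'0 : 0 ≤ H')
    (hZ : ∀ p, |p - τ| ≤ R → HasDerivAt (deriv (deriv X)) (Z p) p) (hZH : ∀ p, |p - τ| ≤ R → ‖Z p‖ ≤ H)
    (hZlip : ∀ p, |p - τ| ≤ R → ‖Z p - Z τ‖ ≤ H' * |p - τ|)
    (hθ1 : θ ≤ 1) (hosc : ∀ u v, ‖deriv X u - deriv X v‖ ≤ θ) (hκm : ∀ s, ‖deriv (deriv X) s‖ ≤ κm)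
    (hκR : ε₀ + ε₁ * (|τ| + R) ≤ κR) (hκ0 : ε₀ + ε₁ * |τ| ≤ κ0) (hsmall : κR * R ≤ 1) :
    Integrable (fun σ : ℝ => (-3 * ⟪X τ - X σ, deriv X τ - deriv X σ⟫_ℝ * ((‖X τ - X σ‖ ^ 2 + e ^ 2) ^ (5 / 2 : ℝ))⁻¹) •
          cross (deriv X σ) (X τ - X σ) +
        ((‖X τ - X σ‖ ^ 2 + e ^ 2) ^ (3 / 2 : ℝ))⁻¹ • (cross (deriv X σ) (deriv X τ - deriv X σ) + cross (deriv (deriv X) σ) (X τ - X σ))) ∧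
      ‖(∫ σ, ((-3 * ⟪X τ - X σ, deriv X τ - deriv X σ⟫_ℝ * ((‖X τ - X σ‖ ^ 2 + e ^ 2) ^ (5 / 2 : ℝ))⁻¹) •
            cross (deriv X σ) (X τ - X σ) +
          ((‖X τ - X σ‖ ^ 2 + e ^ 2) ^ (3 / 2 : ℝ))⁻¹ • (cross (deriv X σ) (deriv X τ - deriv X σ) + cross (deriv (deriv X) σ) (X τ - X σ)))) -
          (Real.arsinh (R / e) - R / Real.sqrt (R ^ 2 + e ^ 2)) • cross (deriv X τ) (Z τ)‖ ≤
        2 * R * (8 * H' + 84 * (κR * H)) + 8 * (κR * R) ^ 2 * H * (Real.arsinh (R / e) - R / Real.sqrt (R ^ 2 + e ^ 2)) +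
          72 * ε₁ * Real.log (L / R) + 72 * Real.pi * κ0 / R + (64 * θ / L + 8 * κm) * (Real.pi / L) := by
  have hL : 0 < L := hR.trans_le hRL
  have hθ0 : 0 ≤ θ := le_trans (norm_nonneg _) (hosc 0 0)
  have hκR0 : 0 ≤ κR := le_trans (by positivity) hκR
  have hκ00 : 0 ≤ κ0 := le_trans (by positivity) hκ0
  have hκm0 : 0 ≤ κm := (norm_nonneg _).trans (hκm 0)
  set Λ : ℝ := Real.arsinh (R / e) - R / Real.sqrt (R ^ 2 + e ^ 2) with hΛ
  set g : ℝ → ℝ := fun σ => (((σ - τ) ^ 2 + e ^ 2) ^ (3 / 2 : ℝ))⁻¹ * ((σ - τ) ^ 2 / 2) with hg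
  have hg0 : ∀ σ, 0 ≤ g σ := fun σ => mul_nonneg (kernel_pos e _ he).le (by positivity)
  have hgc : Continuous g := by
    refine Continuous.mul ?_ (((continuous_id.sub continuous_const).pow 2).div_const 2)
    exact ((((continuous_id.sub continuous_const).pow 2).add continuous_const).rpow_const
      fun _ => Or.inr (by norm_num)).inv₀
      fun σ => (Real.rpow_pos_of_pos (by positivity : (0:ℝ) < (σ - τ) ^ 2 + e ^ 2) _).ne'
  -- the majorant pieces
  set c₁ : ℝ := 8 * H' + 84 * (κR * H) with hc₁
  set c₂ : ℝ := 8 * (κR * R) ^ 2 * H with hc₂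
  set c₄ : ℝ := 64 * θ / L + 8 * κm with hc₄
  set c₅ : ℝ := 72 * κ0 with hc₅
  have hc₁0 : 0 ≤ c₁ := by positivity
  have hc₂0 : 0 ≤ c₂ := by positivity
  have hc₄0 : 0 ≤ c₄ := by positivity
  have hc₅0 : 0 ≤ c₅ := by positivity
  set m₁ : ℝ → ℝ := (Icc (τ - R) (τ + R)).indicator fun σ => c₁ + c₂ * g σ with hm₁
  set m₂ : ℝ → ℝ := (Icc (τ + R) (τ + L)).indicator fun σ => 36 * ε₁ * (σ - τ)⁻¹ + 0 with hm₂
  set m₃ : ℝ → ℝ := (Icc (τ - L) (τ - R)).indicator fun σ => 36 * ε₁ * (τ - σ)⁻¹ + 0 with hm₃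
  set m₄ : ℝ → ℝ := fun σ => c₄ * (L ^ 2 + (σ - τ) ^ 2)⁻¹ with hm₄
  set m₅ : ℝ → ℝ := fun σ => c₅ * (R ^ 2 + (σ - τ) ^ 2)⁻¹ with hm₅
  have hm₁0 : ∀ σ, 0 ≤ m₁ σ := fun σ => by
    rw [hm₁]; exact Set.indicator_nonneg (fun x _ => by have := hg0 x; positivity) σ
  have hm₂0 : ∀ σ, 0 ≤ m₂ σ := fun σ => by
    rw [hm₂]; refine Set.indicator_nonneg (fun x hx => ?_) σ
    have : 0 < x - τ := by linarith [hx.1]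
    positivity
  have hm₃0 : ∀ σ, 0 ≤ m₃ σ := fun σ => by
    rw [hm₃]; refine Set.indicator_nonneg (fun x hx => ?_) σ
    have : 0 < τ - x := by linarith [hx.2]
    positivity
  have hm₄0 : ∀ σ, 0 ≤ m₄ σ := fun σ => by rw [hm₄]; positivity
  have hm₅0 : ∀ σ, 0 ≤ m₅ σ := fun σ => by rw [hm₅]; positivity
  have hI₁ : Integrable m₁ :=
    ((continuous_const.add (continuous_const.mul hgc)).integrableOn_Icc).integrable_indicator measurableSet_Icc
  have hc2 : ContinuousOn (fun σ : ℝ => 36 * ε₁ * (σ - τ)⁻¹ + 0) (Icc (τ + R) (τ + L)) := by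
    refine ((continuousOn_const.mul ((continuousOn_id.sub continuousOn_const).inv₀ fun σ hσ => ?_)).add continuousOn_const)
    simp only [Pi.sub_apply, id_eq]
    exact ne_of_gt (by linarith [hσ.1])
  have hI₂ : Integrable m₂ := (hc2.integrableOn_Icc).integrable_indicator measurableSet_Icc
  have hc3 : ContinuousOn (fun σ : ℝ => 36 * ε₁ * (τ - σ)⁻¹ + 0) (Icc (τ - L) (τ - R)) := by
    refine ((continuousOn_const.mul ((continuousOn_const.sub continuousOn_id).inv₀ fun σ hσ => ?_)).add continuousOn_const)
    simp only [Pi.sub_apply, id_eq]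
    exact ne_of_gt (by linarith [hσ.2])
  have hI₃ : Integrable m₃ := (hc3.integrableOn_Icc).integrable_indicator measurableSet_Icc
  have hI₄ : Integrable m₄ := (integrable_inv_sq_add_sq hL τ).const_mul c₄
  have hI₅ : Integrable m₅ := (integrable_inv_sq_add_sq hR τ).const_mul c₅
  have hv₁ : ∫ σ, m₁ σ = c₁ * (2 * R) + c₂ * Λ := by
    have I1 : IntervalIntegrable (fun _ : ℝ => c₁) volume (τ - R) (τ + R) := continuous_const.intervalIntegrable _ _
    have I2 : IntervalIntegrable (fun σ : ℝ => c₂ * g σ) volume (τ - R) (τ + R) := (continuous_const.mul hgc).intervalIntegrable _ _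
    rw [hm₁, MeasureTheory.integral_indicator measurableSet_Icc, integral_Icc_eq_integral_Ioc,
      ← intervalIntegral.integral_of_le (by linarith : τ - R ≤ τ + R),
      intervalIntegral.integral_add I1 I2,
      intervalIntegral.integral_const, smul_eq_mul, intervalIntegral.integral_const_mul]
    simp only [hg]
    rw [integral_window_model he τ hR.le, ← hΛ]
    ring
  have hv₂ : ∫ σ, m₂ σ = 36 * ε₁ * Real.log (L / R) + 0 * (L - R) := by
    rw [hm₂, MeasureTheory.integral_indicator measurableSet_Icc, integral_Icc_eq_integral_Ioc,
      ← intervalIntegral.integral_of_le (by linarith : τ + R ≤ τ + L), integral_right_zone _ _ τ hR hRL]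
  have hv₃ : ∫ σ, m₃ σ = 36 * ε₁ * Real.log (L / R) + 0 * (L - R) := by
    rw [hm₃, MeasureTheory.integral_indicator measurableSet_Icc, integral_Icc_eq_integral_Ioc,
      ← intervalIntegral.integral_of_le (by linarith : τ - L ≤ τ - R), integral_left_zone _ _ τ hR hRL]
  have hv₄ : ∫ σ, m₄ σ = c₄ * (Real.pi / L) := by
    rw [hm₄, MeasureTheory.integral_const_mul, integral_inv_sq_add_sq hL τ]
  have hv₅ : ∫ σ, m₅ σ = c₅ * (Real.pi / R) := by
    rw [hm₅, MeasureTheory.integral_const_mul, integral_inv_sq_add_sq hR τ]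
  set m : ℝ → ℝ := fun σ => m₁ σ + m₂ σ + m₃ σ + m₄ σ + m₅ σ with hm
  have hmI : Integrable m := (((hI₁.add hI₂).add hI₃).add hI₄).add hI₅
  -- the pointwise majorant
  have hmaj : ∀ σ, ‖((-3 * ⟪X τ - X σ, deriv X τ - deriv X σ⟫_ℝ * ((‖X τ - X σ‖ ^ 2 + e ^ 2) ^ (5 / 2 : ℝ))⁻¹) •
          cross (deriv X σ) (X τ - X σ) +
        ((‖X τ - X σ‖ ^ 2 + e ^ 2) ^ (3 / 2 : ℝ))⁻¹ • (cross (deriv X σ) (deriv X τ - deriv X σ) + cross (deriv (deriv X) σ) (X τ - X σ))) -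
      (Icc (τ - R) (τ + R)).indicator
        (fun σ => ((((σ - τ) ^ 2 + e ^ 2) ^ (3 / 2 : ℝ))⁻¹ * ((σ - τ) ^ 2 / 2)) • cross (deriv X τ) (Z τ)) σ‖ ≤ m σ := by
    intro σ
    by_cases hin : |σ - τ| ≤ R
    · -- zone 1
      have hmem : σ ∈ Icc (τ - R) (τ + R) := by
        rw [abs_le] at hin; exact ⟨by linarith [hin.1], by linarith [hin.2]⟩
      rw [Set.indicator_of_mem hmem]
      have h1 := majorant_zone_window_deriv hX hunit he hε₁ henv hH0 hH'0 hZ hZH hZlip hκR hsmall hin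
      have hm₁σ : m₁ σ = c₁ + c₂ * g σ := by rw [hm₁, Set.indicator_of_mem hmem]
      have : 8 * H' + 84 * (κR * H) + 8 * (κR * R) ^ 2 * H * g σ = m₁ σ := by rw [hm₁σ]
      calc _ ≤ 8 * H' + 84 * (κR * H) + 8 * (κR * R) ^ 2 * H * g σ := h1
        _ = m₁ σ := this
        _ ≤ m σ := by rw [hm]; linarith [hm₂0 σ, hm₃0 σ, hm₄0 σ, hm₅0 σ]
    · push Not at hin
      have hnmem : σ ∉ Icc (τ - R) (τ + R) := by
        intro h
        have : |σ - τ| ≤ R := abs_le.2 ⟨by linarith [h.1], by linarith [h.2]⟩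
        linarith
      rw [Set.indicator_of_notMem hnmem, sub_zero]
      by_cases hmid : |σ - τ| ≤ L
      · -- zone 2: 36κ0/s² + 36ε₁/|s| ≤ m₅ + (m₂ or m₃)
        have h2 := majorant_zone_envelope_deriv hX hunit he hε₁ henv hθ1 hosc hκ0 hR hin
        have hs2 : 0 < (σ - τ) ^ 2 := by rw [← sq_abs]; exact pow_pos (hR.trans hin) 2
        have h5 : 36 * κ0 / (σ - τ) ^ 2 ≤ m₅ σ := by
          simp only [hm₅, hc₅]
          have hR2 : R ^ 2 ≤ (σ - τ) ^ 2 := by have := pow_le_pow_left₀ hR.le hin.le 2; rwa [sq_abs] at this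
          have hpos2 : 0 < R ^ 2 + (σ - τ) ^ 2 := by positivity
          rw [show 72 * κ0 * (R ^ 2 + (σ - τ) ^ 2)⁻¹ = 72 * κ0 / (R ^ 2 + (σ - τ) ^ 2) by ring,
            div_le_div_iff₀ hs2 hpos2]
          nlinarith
        rcases lt_or_gt_of_ne (show σ - τ ≠ 0 from fun h => by rw [h, abs_zero] at hin; linarith) with hneg | hpos
        · -- left piece
          have habs : |σ - τ| = τ - σ := by rw [abs_of_neg hneg]; ring
          have hmem : σ ∈ Icc (τ - L) (τ - R) := ⟨by rw [habs] at hmid; linarith, by rw [habs] at hin; linarith⟩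
          have hm₃σ : m₃ σ = 36 * ε₁ * (τ - σ)⁻¹ + 0 := by rw [hm₃, Set.indicator_of_mem hmem]
          have h3 : 36 * ε₁ / |σ - τ| = m₃ σ := by rw [hm₃σ, habs, div_eq_mul_inv]; ring
          calc _ ≤ 36 * κ0 / (σ - τ) ^ 2 + 36 * ε₁ / |σ - τ| := h2
            _ ≤ m₅ σ + m₃ σ := by rw [← h3]; linarith
            _ ≤ m σ := by rw [hm]; linarith [hm₁0 σ, hm₂0 σ, hm₄0 σ]
        · -- right piece
          have habs : |σ - τ| = σ - τ := abs_of_pos hpos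
          have hmem : σ ∈ Icc (τ + R) (τ + L) := ⟨by rw [habs] at hin; linarith, by rw [habs] at hmid; linarith⟩
          have hm₂σ : m₂ σ = 36 * ε₁ * (σ - τ)⁻¹ + 0 := by rw [hm₂, Set.indicator_of_mem hmem]
          have h3 : 36 * ε₁ / |σ - τ| = m₂ σ := by rw [hm₂σ, habs, div_eq_mul_inv]; ring
          calc _ ≤ 36 * κ0 / (σ - τ) ^ 2 + 36 * ε₁ / |σ - τ| := h2
            _ ≤ m₅ σ + m₂ σ := by rw [← h3]; linarith
            _ ≤ m σ := by rw [hm]; linarith [hm₁0 σ, hm₃0 σ, hm₄0 σ]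
      · -- zone 3
        push Not at hmid
        have h3 := majorant_zone_far_deriv hX hunit he hθ1 hosc hκm hL hmid
        calc _ ≤ c₄ * (L ^ 2 + (σ - τ) ^ 2)⁻¹ := h3
          _ = m₄ σ := by rw [hm₄]
          _ ≤ m σ := by rw [hm]; linarith [hm₁0 σ, hm₂0 σ, hm₃0 σ, hm₅0 σ]
  have hF : AEStronglyMeasurable (fun σ : ℝ => (-3 * ⟪X τ - X σ, deriv X τ - deriv X σ⟫_ℝ *
        ((‖X τ - X σ‖ ^ 2 + e ^ 2) ^ (5 / 2 : ℝ))⁻¹) • cross (deriv X σ) (X τ - X σ) +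
      ((‖X τ - X σ‖ ^ 2 + e ^ 2) ^ (3 / 2 : ℝ))⁻¹ • (cross (deriv X σ) (deriv X τ - deriv X σ) + cross (deriv (deriv X) σ) (X τ - X σ)))
      volume := (continuous_symmDerivIntegrand hX (q := e ^ 2) (by positivity) τ (deriv X τ)).aestronglyMeasurable
  obtain ⟨hFint, hbound⟩ := integral_sub_windowModel_le_of_majorant hF (cross (deriv X τ) (Z τ)) he τ hR.le hmI hmaj
  have hsum : ∫ σ, m σ = (c₁ * (2 * R) + c₂ * Λ) + (36 * ε₁ * Real.log (L / R) + 0 * (L - R)) +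
      (36 * ε₁ * Real.log (L / R) + 0 * (L - R)) + c₄ * (Real.pi / L) + c₅ * (Real.pi / R) := by
    have h12 : Integrable (fun σ => m₁ σ + m₂ σ) := hI₁.add hI₂
    have h123 : Integrable (fun σ => m₁ σ + m₂ σ + m₃ σ) := h12.add hI₃
    have h1234 : Integrable (fun σ => m₁ σ + m₂ σ + m₃ σ + m₄ σ) := h123.add hI₄
    simp only [hm]
    rw [integral_add h1234 hI₅, integral_add h123 hI₄, integral_add h12 hI₃, integral_add hI₁ hI₂, hv₁, hv₂, hv₃, hv₄, hv₅]
  refine ⟨hFint, hbound.trans (le_of_eq ?_)⟩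
  rw [hsum, hc₁, hc₂, hc₄, hc₅]
  field_simp
  ring

end Summit.NavierStokesRegularity.NavierStokesRegularity.Theorems.SkeletonJ1RLiaSelf

end
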